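import Summits.QuantumFields.YangMills.Theorems.LuscherReductionRunningReductionAxialGauge
import Summits.QuantumFields.YangMills.Theorems.LuscherReductionRunningReductionInnerRegion
import HarnessLib

/-!
# INNER families in comb-gauge coordinates: `orbitDist U < δ ⇒` every comb-gauge link is within `(6L+1)·δ` of `1`
# (sub-stub C4a‴ of the fixed-lattice programme COARSE(L₀) — route `LuscherReduction`, crux RED stmt-QuantumFields-19978 KT-door 3b′ /
# crux `TwistedTraceScaling` stmt-QuantumFields-20203 S-BASE; design note `pub/ym-fleet/ym-luscher-20007-p1/COARSE-DESIGN.md` §4, §9 (iii))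

The one-orbit INNER NO-INTRUDER text `InnerNoIntruderOneOrbitAt L δ` (`…CoarseUpperCopies`) quantifies over gauge-invariant functions supported in
`{orbitDist U < δ}`; the Born–Oppenheimer analysis runs in the comb gauge (`…TreeGauge`, `…AxialGauge`: `⟨G,K_βG⟩ = ∫∫ g·axialKernel·g`,
`g = G ∘ glue`).  This file supplies the dictionary between the two supports:
* `treeGauge_glue`, `treeFix_glue` — a glued configuration (tree links `1`) is its own comb gauge;
* ★ `frobNorm_treeFix_sub_one_le_of_orbitDist_lt` — `orbitDist U < δ ⇒ ‖treeFix U e − 1‖_F ≤ (6L+1)·δ` for every link (minimising gauge +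
  `frobNorm_treeFix_sub_one_le` + covariance `treeFix_gaugeTransform`);
* ★ `glue_support_of_orbitDist` — for gauge-invariant `G` supported in `{orbitDist < δ}`: `G(glue w) ≠ 0 ⇒ ∀ i, ‖w_i − 1‖_F ≤ (6L+1)·δ`, i.e. `g = G ∘ glue`
  lives in the Frobenius box of radius `(6L+1)δ` about `1 ∈ SU(2)^{off}` (so for `δ = β^{−p}` the axial-gauge links of an inner family are `O(Lβ^{−p})`);
* conversely `orbitDist_glue_le` — `orbitDist (glue w) ≤ Σ_i ‖w_i − 1‖_F`.
HONEST FRAMING: bookkeeping; femto rung R2b1; not infinite volume, not a gap, not Clay.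
-/

set_option autoImplicit false

noncomputable section

open MeasureTheory Filter Topology Real
open scoped Matrix ComplexConjugate BigOperators Matrix.Norms.Frobenius
open Literature.MathematicalPhysics.QuantumFieldTheory
open Literature.MathematicalPhysics.QuantumLattice

namespace Summit.QuantumFields.YangMills.Theorems.FemtoTransferGap

variable {L : ℕ} [NeZero L]

/-! ## §1 Glued configurations are in comb gauge -/

omit [NeZero L] in
/-- A partial line of the trivial configuration is `1`. [folklore] -/
theorem lineProd_one (x : Site 3 L) (k : Fin 3) (n : ℕ) : lineProd (fun _ : Edge 3 L => (1 : SU2)) x k n = 1 := by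
  induction n with
  | zero => rfl
  | succ n ih => rw [lineProd_succ, ih, one_mul]

omit [NeZero L] in
/-- The comb transporter of the trivial configuration is `1`. [folklore] -/
theorem treeGauge_one (x : Site 3 L) : treeGauge (fun _ : Edge 3 L => (1 : SU2)) x = 1 := by
  unfold treeGauge; rw [lineProd_one, lineProd_one, lineProd_one, one_mul, one_mul]

/-- The comb transporter of a glued configuration is `1` (its tree links are `1`). [folklore] -/
theorem treeGauge_glue (w : OffIdx L → SU2) (x : Site 3 L) : treeGauge (glue w) x = 1 := by
  rw [treeGauge_congr (U' := fun _ : Edge 3 L => (1 : SU2)) (fun e he => glue_apply_of_tree w he) x, treeGauge_one]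

/-- ★ A glued configuration is its own comb gauge: `treeFix (glue w) = glue w`. [folklore] -/
theorem treeFix_glue (w : OffIdx L → SU2) : treeFix (glue w) = glue w := by
  funext e
  show treeGauge (glue w) e.1 * glue w e * (treeGauge (glue w) (e.1.shift e.2))⁻¹ = glue w e
  rw [treeGauge_glue, treeGauge_glue, one_mul, inv_one, mul_one]

/-! ## §2 Inner configurations in the comb gauge -/

/-- ★ **`orbitDist U < δ ⇒` every comb-gauge link is within `(6L+1)·δ` of `1`.** [folklore] -/
theorem frobNorm_treeFix_sub_one_le_of_orbitDist_lt {U : GaugeConfig 3 L SU2} {δ : ℝ} (hU : orbitDist U < δ) (e : Edge 3 L) :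
    frobNorm ((treeFix U e : Matrix (Fin 2) (Fin 2) ℂ) - 1) ≤ (6 * L + 1) * δ := by
  have hδ : 0 ≤ δ := (orbitDist_nonneg U).trans hU.le
  obtain ⟨g, hg⟩ := exists_gauge_near_of_orbitDist_lt hU
  have h := frobNorm_treeFix_sub_one_le (gaugeTransform g U) hδ (fun e _ => (hg e).le) (fun e => (hg e).le) e
  rw [treeFix_gaugeTransform, gaugeTransform_const_apply, frobNorm_conj_sub_one] at h
  linarith

/-- ★ **Inner families live in the comb box**: for gauge-invariant `G` supported in `{orbitDist < δ}`, `G (glue w) ≠ 0 ⇒ ‖w_i − 1‖_F ≤ (6L+1)δ`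
for every non-tree link `i`. [folklore] -/
theorem glue_support_of_orbitDist {G : GaugeConfig 3 L SU2 → ℝ} {δ : ℝ} (hG : ∀ U, G U ≠ 0 → orbitDist U < δ)
    {w : OffIdx L → SU2} (hw : G (glue w) ≠ 0) (i : OffIdx L) :
    frobNorm ((w i : Matrix (Fin 2) (Fin 2) ℂ) - 1) ≤ (6 * L + 1) * δ := by
  have h := frobNorm_treeFix_sub_one_le_of_orbitDist_lt (hG _ hw) i.1
  rwa [treeFix_glue, glue_apply_of_not_tree w i.2] at h

/-- The same for the members of a one-orbit inner family and their combinations. [folklore] -/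
theorem glue_support_of_sum_mul {k : ℕ} {Gfam : Fin (k + 1) → GaugeConfig 3 L SU2 → ℝ} {δ : ℝ}
    (hG : ∀ i U, Gfam i U ≠ 0 → orbitDist U < δ) (a : Fin (k + 1) → ℝ) {w : OffIdx L → SU2}
    (hw : ∑ i, a i * Gfam i (glue w) ≠ 0) (j : OffIdx L) :
    frobNorm ((w j : Matrix (Fin 2) (Fin 2) ℂ) - 1) ≤ (6 * L + 1) * δ := by
  obtain ⟨i, -, hi⟩ := Finset.exists_ne_zero_of_sum_ne_zero hw
  exact glue_support_of_orbitDist (hG i) (right_ne_zero_of_mul hi) j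

/-! ## §3 Conversely: the comb box is inner -/

/-- `orbitDist (glue w) ≤ Σ_i ‖w_i − 1‖_F` (the identity gauge). [folklore] -/
theorem orbitDist_glue_le (w : OffIdx L → SU2) :
    orbitDist (glue w) ≤ ∑ i : OffIdx L, frobNorm ((w i : Matrix (Fin 2) (Fin 2) ℂ) - 1) := by
  refine (orbitDist_le (1 : Site 3 L → SU2) (glue w)).trans (le_of_eq ?_)
  unfold gaugeDist
  rw [TT.gaugeTransform_one', ← Finset.sum_filter_add_sum_filter_not Finset.univ (fun e : Edge 3 L => treeEdge e = true)]
  have h0 : ∑ e ∈ Finset.univ.filter (fun e : Edge 3 L => treeEdge e = true), frobNorm (((glue w e : SU2) : Matrix (Fin 2) (Fin 2) ℂ) - 1) = 0 :=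
    Finset.sum_eq_zero fun e he => by
      rw [Finset.mem_filter] at he
      rw [glue_apply_of_tree w he.2]
      simp [frobNorm_zero]
  rw [h0, zero_add, Finset.sum_subtype (Finset.univ.filter fun e : Edge 3 L => ¬ treeEdge e = true) (p := fun e : Edge 3 L => ¬ treeEdge e = true)
    (fun e => by simp)]
  exact Finset.sum_congr rfl fun i _ => by rw [glue_apply_of_not_tree w i.2]

end Summit.QuantumFields.YangMills.Theorems.FemtoTransferGap

end
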